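import Literature.NumberTheory.LFunctions.ClassGroupSmoothedSums

/-!
# Long smoothed sums `Σ a(n) n^{-β} Φ(u − log n)` with Weiss's kernel at a ZERO `β` of the `L`-series

Topic `Literature/NumberTheory/LFunctions`, namespace `Literature.NumberTheory.LFunctions.WeissKernel`
(continuing `WeissKernel.lean` and `ClassGroupSmoothedSums.lean`).  Everything here is PROVED
(two definitions with bodies, theorems; no named facts).

`ClassGroupSmoothedSums.lean` treats the SHORT sums `S_a(u) = Σ a(n) n^{-1} φ_{m+1}(u − log n)` with
Weiss's compactly supported kernel `φ_{m+1}` (window `N𝔞 ≍ e^u`).  For Bombieri's Lemme C in a number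
field ("the exceptional prime ideals are rare", `DedekindZetaExceptionalPrimes.lean`) one needs LONG sums,
over all `n ≲ e^u`, weighted by `n^{-β}` at a real ZERO `β` of the `L`-series:

* `longCutoff A m v = Φ(v) = ∫_{t ≤ v} φ_{m+1}(t) dt` — nondecreasing, `0 ≤ Φ ≤ 1`, `Φ = 0` left of
  `−(m+1)/A` and `Φ = 1` right of `(m+1)/A`; its Mellin representation on a line `Re s = −c < 0`:
  `Φ(v) = (1/2π) ∫ e^{−vs} Ψ̂(s) (−1/s) dt` (`longCutoff_eq_integral`; `Ψ̂(s) = (sinh(s/A)/(s/A))^{m+1}`,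
  Fubini over `phi_eq_integral`);
* `longSum a β A m u = Σ_n a(n) n^{−β} Φ(u − log n)` and `longSum_eq_integral` —
  `= (1/2π) ∫ e^{−us} Ψ̂(s) (−1/s) L(a, β − s) dt` on `Re s = −c` whenever `Σ |a(n)| n^{−β−c} < ∞`;
* `longSum_eq_add_integral`, **`norm_longSum_sub_le`** — if `L(a, z) = F(z)/(z − 1)` (`Re z > 1`) for an
  entire `F` with `|F(z)| ≤ M|z + 5/2|^N` on `Re z ≥ −1/2`, `m ≥ N + 2`, and **`F(β) = 0`** for some
  `3/4 ≤ β < 1`, then with `δ = 1 − β`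

  `|longSum a β A m u − F(1) Ψ̂(δ) e^{uδ}/δ| ≤ 2 M C e^{−u/2}`, `C = majorConst A m N`:

  the line `Re s = −1/2` is moved to `Re s = 1/2` across the simple pole at `s = −δ` (the pole of
  `L(a, ·)` at `1`); the would-be pole of the kernel `1/s` at `s = 0` is CANCELLED by the zero
  `F(β) = 0`, so that, unlike at a generic point, the long sum has NO constant term — its main term
  `F(1)Ψ̂(δ)e^{uδ}/δ` is exact up to `O(e^{−u/2})`.  This is the device behind the bounds for
  `Σ_{n ≤ x} (1 ∗ χ)(n) n^{−β}` at an exceptional zero (Bombieri, *Le grand crible*, §6 Lemme C;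
  Tao–Teräväinen 2021, proof of Prop. 3.5), in the smoothed form natural for the tree's Weiss-kernel
  machinery (`smoothedSum_eq_integral`, `Montgomery.integral_vertical_div_sub_eq`).

## References

* E. Bombieri, *Le grand crible dans la théorie analytique des nombres*, Astérisque 18 (1987), §6,
  Lemme C. [Bombieri1987GrandCrible]
* J. Thorner, A. Zaman, *An explicit bound for the least prime ideal in the Chebotarev density
  theorem*, Algebra Number Theory 11 (2017), Lemmas 4.3–4.4 (Weiss's kernel and its Mellin transform).
  [ThornerZaman2017]
-/

noncomputable section

open MeasureTheory Real Complex Set Filter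
open scoped Topology

namespace Literature.NumberTheory.LFunctions.WeissKernel

variable {A : ℝ}

/-! ### The long cutoff `Φ(v) = ∫_{t ≤ v} φ_{m+1}(t) dt` -/

/-- The long cutoff `Φ_{m+1}(v) = ∫_{t ≤ v} φ_{m+1}(t) dt` attached to Weiss's kernel.
[cite: ThornerZaman2017, Lemma 4.3] -/
def longCutoff (A : ℝ) (m : ℕ) (v : ℝ) : ℝ := ∫ t in Iic v, phi A m t

/-- `0 ≤ Φ`. [folklore] -/
theorem longCutoff_nonneg (hA : 0 < A) (m : ℕ) (v : ℝ) : 0 ≤ longCutoff A m v :=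
  setIntegral_nonneg measurableSet_Iic fun t _ ↦ phi_nonneg hA m t

/-- `Φ ≤ 1`. [folklore] -/
theorem longCutoff_le_one (hA : 0 < A) (m : ℕ) (v : ℝ) : longCutoff A m v ≤ 1 := by
  rw [longCutoff, ← integral_phi hA m]
  exact setIntegral_le_integral (integrable_phi A m) (Eventually.of_forall (phi_nonneg hA m))

/-- `Φ` is nondecreasing. [folklore] -/
theorem longCutoff_mono (hA : 0 < A) (m : ℕ) {v v' : ℝ} (h : v ≤ v') :
    longCutoff A m v ≤ longCutoff A m v' :=
  setIntegral_mono_set (integrable_phi A m).integrableOn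
    (Eventually.of_forall (phi_nonneg hA m)) (Iic_subset_Iic.mpr h).eventuallyLE

/-- `Φ(v) = 0` for `v < −(m+1)/A`. [folklore] -/
theorem longCutoff_eq_zero (hA : 0 < A) (m : ℕ) {v : ℝ} (hv : v < -(((m : ℝ) + 1) / A)) :
    longCutoff A m v = 0 := by
  refine setIntegral_eq_zero_of_forall_eq_zero fun t ht ↦ phi_eq_zero_of_lt hA m ?_
  rw [mem_Iic] at ht
  have : t < 0 := by
    have : 0 < ((m : ℝ) + 1) / A := by positivity
    linarith
  rw [abs_of_neg this]; linarith

/-- `Φ(v) = 1` for `v > (m+1)/A`. [folklore] -/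
theorem longCutoff_eq_one (hA : 0 < A) (m : ℕ) {v : ℝ} (hv : ((m : ℝ) + 1) / A < v) :
    longCutoff A m v = 1 := by
  have h := integral_add_compl (μ := volume) measurableSet_Iic (integrable_phi A m) (s := Iic v)
  rw [integral_phi hA m] at h
  have h0 : ∫ t in (Iic v)ᶜ, phi A m t = 0 := by
    refine setIntegral_eq_zero_of_forall_eq_zero fun t ht ↦ phi_eq_zero_of_lt hA m ?_
    rw [mem_compl_iff, mem_Iic, not_le] at ht
    have hw : 0 < ((m : ℝ) + 1) / A := by positivity
    rw [abs_of_pos (by linarith)]; linarith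
  rw [h0, add_zero] at h
  exact h

/-- `Φ(v) = 1` for `v ≥ (m+1)/A + 1` (a convenient closed form of `longCutoff_eq_one`). [folklore] -/
theorem longCutoff_eq_one_of_le (hA : 0 < A) (m : ℕ) {v : ℝ} (hv : ((m : ℝ) + 1) / A + 1 ≤ v) :
    longCutoff A m v = 1 :=
  longCutoff_eq_one hA m (by linarith)

/-! ### Mellin representation of the long cutoff -/

/-- **`Φ(v) = (1/2π) ∫ e^{−vs} Ψ̂(s) (−1/s) dt` on the line `Re s = −c`, `c > 0`** (`m ≥ 1`):
insert `phi_eq_integral` under `∫_{t ≤ v}` and integrate `∫_{w ≤ v} e^{−ws} dw = e^{−vs}/(−s)`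
(Fubini; `Re(−s) = c > 0`). [cite: ThornerZaman2017, Lemma 4.3 (ii)] -/
theorem longCutoff_eq_integral (hA : 0 < A) {m : ℕ} (hm : 1 ≤ m) {c : ℝ} (hc : 0 < c) (v : ℝ) :
    (longCutoff A m v : ℂ) = (1 / (2 * π) : ℝ) *
      ∫ t : ℝ, Complex.exp (-(v : ℂ) * ((-c : ℝ) + t * I)) *
        laplaceFactor A ((-c : ℝ) + t * I) ^ (m + 1) * (-1 / ((-c : ℝ) + t * I)) := by
  set sv : ℝ → ℂ := fun t ↦ ((-c : ℝ) : ℂ) + t * I with hsv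
  set Λk : ℝ → ℂ := fun t ↦ laplaceFactor A (sv t) ^ (m + 1) with hΛk
  have hΛi : Integrable Λk := integrable_laplaceFactor_pow_vertical hA hm (-c)
  have hΛc : Continuous Λk := ((differentiable_laplaceFactor hA).continuous.comp (by fun_prop)).pow _
  -- the integrand of the double integral
  set f : ℝ → ℝ → ℂ := fun w t ↦ Complex.exp (-(w : ℂ) * sv t) * Λk t with hf
  have hnormexp : ∀ (w t : ℝ), ‖Complex.exp (-(w : ℂ) * sv t)‖ = Real.exp (w * c) := by
    intro w t
    rw [Complex.norm_exp]
    congr 1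
    simp [hsv]
  -- integrability on `(Iic v) × ℝ`
  have hsvc : Continuous sv := by simp only [hsv]; fun_prop
  have hfi : Integrable (Function.uncurry f) ((volume.restrict (Iic v)).prod volume) := by
    have hmaj : Integrable (fun z : ℝ × ℝ ↦ Real.exp (c * z.1) * ‖Λk z.2‖)
        ((volume.restrict (Iic v)).prod volume) :=
      Integrable.mul_prod (integrableOn_exp_mul_Iic hc v) hΛi.norm
    have hcont : Continuous (Function.uncurry f) := by
      have e : Function.uncurry f = fun z : ℝ × ℝ ↦ Complex.exp (-(z.1 : ℂ) * sv z.2) * Λk z.2 := by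
        funext z; rfl
      rw [e]
      exact (Complex.continuous_exp.comp (((Complex.continuous_ofReal.comp continuous_fst).neg).mul
        (hsvc.comp continuous_snd))).mul (hΛc.comp continuous_snd)
    refine hmaj.mono' hcont.aestronglyMeasurable (Eventually.of_forall fun z ↦ ?_)
    show ‖f z.1 z.2‖ ≤ Real.exp (c * z.1) * ‖Λk z.2‖
    rw [hf]
    dsimp only
    rw [norm_mul, hnormexp, mul_comm z.1 c]
  -- Fubini
  have hswap := integral_integral_swap hfi
  -- the inner `w`-integral
  have hinner : ∀ t : ℝ, ∫ w in Iic v, f w t = Complex.exp (-(v : ℂ) * sv t) * Λk t * (-1 / sv t) := by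
    intro t
    rw [hf]; dsimp only
    rw [integral_mul_const]
    have hre : 0 < (-sv t).re := by simp [hsv, hc]
    have e : ∀ w : ℝ, Complex.exp (-(w : ℂ) * sv t) = Complex.exp (-sv t * w) := fun w ↦ by ring_nf
    simp_rw [e]
    rw [integral_exp_mul_complex_Iic hre v]
    have hs0 : sv t ≠ 0 := by
      intro h; have := congrArg Complex.re h; simp [hsv] at this; linarith
    field_simp
  -- assemble
  have hstep : (longCutoff A m v : ℂ) = ∫ w in Iic v, (phi A m w : ℂ) := by
    rw [longCutoff]; exact integral_ofReal.symm
  rw [hstep]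
  have hphi : ∀ w : ℝ, (phi A m w : ℂ) = (1 / (2 * π) : ℝ) * ∫ t, f w t := by
    intro w
    rw [phi_eq_integral hA hm (-c) w, hf]
  simp_rw [hphi]
  rw [integral_const_mul]
  congr 1
  rw [hswap]
  refine integral_congr_ae (Eventually.of_forall fun t ↦ ?_)
  exact hinner t

/-! ### The long sums -/

/-- **The long smoothed sum** `Σ_{n ≥ 1} a(n) n^{−β} Φ_{m+1}(u − log n)` (the term `n = 0` vanishes for
`β ≠ 0`). [cite: Bombieri1987GrandCrible, §6 Lemme C] -/
def longSum (a : ℕ → ℂ) (β A : ℝ) (m : ℕ) (u : ℝ) : ℂ :=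
  ∑' n : ℕ, a n * (n : ℂ) ^ (-(β : ℂ)) * (longCutoff A m (u - Real.log n) : ℂ)

/-- `a(n) n^{−(β − s)} = a(n) n^{−β} e^{s log n}`, the term of `L(a, β − s)`. [folklore] -/
theorem term_sub_eq (a : ℕ → ℂ) {β : ℝ} (hβ : β ≠ 0) (s : ℂ) (n : ℕ) :
    LSeries.term a ((β : ℂ) - s) n = a n * (n : ℂ) ^ (-(β : ℂ)) * Complex.exp ((Real.log n : ℂ) * s) := by
  rcases eq_or_ne n 0 with rfl | hn
  · have : (-(β : ℂ)) ≠ 0 := by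
      rw [neg_ne_zero]; exact_mod_cast hβ
    simp [LSeries.term, Complex.zero_cpow this]
  · have hn' : (n : ℂ) ≠ 0 := by exact_mod_cast hn
    rw [LSeries.term, if_neg hn, div_eq_mul_inv, ← Complex.cpow_neg, neg_sub,
      show s - (β : ℂ) = -(β : ℂ) + s by ring, Complex.cpow_add _ _ hn',
      Complex.cpow_def_of_ne_zero hn' s, ← Complex.natCast_log]
    ring

/-- **The long sum as a vertical integral to the LEFT of `0`**: for `c > 0`, `β ≠ 0` with
`Σ |a(n)| n^{−β−c} < ∞`, `m ≥ 1` and every real `u`,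
`longSum a β A m u = (1/2π) ∫ e^{−us} Ψ̂(s) (−1/s) L(a, β − s) dt`, `s = −c + it`
(insert `longCutoff_eq_integral` term by term; the double sum–integral converges absolutely).
[cite: Bombieri1987GrandCrible, §6 Lemme C] -/
theorem longSum_eq_integral (hA : 0 < A) {m : ℕ} (hm : 1 ≤ m) {c : ℝ} (hc : 0 < c) {β : ℝ}
    (hβ : β ≠ 0) {a : ℕ → ℂ} (ha : LSeriesSummable a ((β + c : ℝ) : ℂ)) (u : ℝ) :
    longSum a β A m u = (1 / (2 * π) : ℝ) *
      ∫ t : ℝ, Complex.exp (-(u : ℂ) * ((-c : ℝ) + t * I)) *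
        laplaceFactor A ((-c : ℝ) + t * I) ^ (m + 1) * (-1 / ((-c : ℝ) + t * I)) *
          LSeries a ((β : ℂ) - ((-c : ℝ) + t * I)) := by
  set sv : ℝ → ℂ := fun t ↦ ((-c : ℝ) : ℂ) + t * I with hsv
  set Λk : ℝ → ℂ := fun t ↦ laplaceFactor A (sv t) ^ (m + 1) * (-1 / sv t) with hΛk
  have hsnorm : ∀ t : ℝ, c ≤ ‖sv t‖ := by
    intro t
    have := Complex.abs_re_le_norm (sv t)
    simp only [hsv, Complex.add_re, Complex.ofReal_re, Complex.mul_re, Complex.I_re, mul_zero,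
      Complex.ofReal_im, Complex.I_im, mul_one, sub_self, add_zero, abs_neg, abs_of_pos hc] at this
    exact this
  have hs0 : ∀ t : ℝ, sv t ≠ 0 := fun t h ↦ by
    have := hsnorm t; rw [h, norm_zero] at this; linarith
  have hΛc : Continuous Λk := by
    refine (((differentiable_laplaceFactor hA).continuous.comp (by fun_prop)).pow _).mul ?_
    exact Continuous.div continuous_const (by fun_prop) hs0
  have hΛi : Integrable Λk := by
    refine Integrable.mono' ((integrable_laplaceFactor_pow_vertical hA hm (-c)).norm.const_mul (1 / c))
      hΛc.aestronglyMeasurable (Eventually.of_forall fun t ↦ ?_)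
    rw [hΛk]; dsimp only
    rw [norm_mul, norm_div, norm_neg, norm_one]
    have h1 : 1 / ‖sv t‖ ≤ 1 / c := div_le_div_of_nonneg_left zero_le_one hc (hsnorm t)
    calc ‖laplaceFactor A (sv t) ^ (m + 1)‖ * (1 / ‖sv t‖)
        ≤ ‖laplaceFactor A (sv t) ^ (m + 1)‖ * (1 / c) := mul_le_mul_of_nonneg_left h1 (norm_nonneg _)
      _ = 1 / c * ‖laplaceFactor A (sv t) ^ (m + 1)‖ := by ring
  set MΛ : ℝ := ∫ t, ‖Λk t‖ with hMΛ
  -- the pieces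
  set F : ℕ → ℝ → ℂ := fun n t ↦ (1 / (2 * π) : ℝ) *
    (a n * (n : ℂ) ^ (-(β : ℂ)) * (Complex.exp (-((u - Real.log n : ℝ) : ℂ) * sv t) * Λk t)) with hF
  -- (i) each term is `∫ F n`
  have hterm : ∀ n : ℕ, a n * (n : ℂ) ^ (-(β : ℂ)) * (longCutoff A m (u - Real.log n) : ℂ) =
      ∫ t, F n t := by
    intro n
    have e1 : (fun t : ℝ ↦ Complex.exp (-((u - Real.log n : ℝ) : ℂ) * sv t) * Λk t) =
        fun t : ℝ ↦ Complex.exp (-((u - Real.log n : ℝ) : ℂ) * ((-c : ℝ) + t * I)) *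
          laplaceFactor A ((-c : ℝ) + t * I) ^ (m + 1) * (-1 / ((-c : ℝ) + t * I)) := by
      funext t; simp only [hΛk, hsv]; ring
    rw [hF]
    dsimp only
    rw [integral_const_mul, integral_const_mul, e1, longCutoff_eq_integral hA hm hc (u - Real.log n)]
    ring
  have hnormexp : ∀ (w t : ℝ), ‖Complex.exp (-(w : ℂ) * sv t)‖ = Real.exp (w * c) := by
    intro w t
    rw [Complex.norm_exp]
    congr 1
    simp [hsv]
  -- (ii) integrability of each `F n`
  have hFi : ∀ n, Integrable (F n) := by
    intro n
    refine Integrable.const_mul (Integrable.const_mul ?_ _) _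
    refine Integrable.bdd_mul (c := Real.exp ((u - Real.log n) * c)) hΛi
      (Continuous.aestronglyMeasurable (by fun_prop)) (Eventually.of_forall fun t ↦ ?_)
    exact (hnormexp _ t).le
  -- (iii) `Σ ∫ |F n| < ∞`
  have hnβ : ∀ n : ℕ, ‖(n : ℂ) ^ (-(β : ℂ))‖ = if n = 0 then 0 else (n : ℝ) ^ (-β) := by
    intro n
    split_ifs with hn
    · subst hn
      have : (-(β : ℂ)) ≠ 0 := by rw [neg_ne_zero]; exact_mod_cast hβ
      rw [Nat.cast_zero, Complex.zero_cpow this, norm_zero]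
    · rw [Complex.norm_natCast_cpow_of_pos (Nat.pos_of_ne_zero hn)]; simp
  have hFnorm : ∀ n, ∫ t, ‖F n t‖ = (1 / (2 * π)) * (‖a n‖ * ‖(n : ℂ) ^ (-(β : ℂ))‖ *
      Real.exp ((u - Real.log n) * c)) * MΛ := by
    intro n
    have e : ∀ t, ‖F n t‖ = (1 / (2 * π)) * (‖a n‖ * ‖(n : ℂ) ^ (-(β : ℂ))‖ *
        Real.exp ((u - Real.log n) * c)) * ‖Λk t‖ := by
      intro t
      rw [hF]; dsimp only
      rw [norm_mul, norm_mul, norm_mul, norm_mul, hnormexp, Complex.norm_real, Real.norm_eq_abs,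
        abs_of_pos (by positivity)]
      ring
    simp_rw [e]
    rw [integral_const_mul, hMΛ]
  have hsum : Summable fun n ↦ ∫ t, ‖F n t‖ := by
    simp_rw [hFnorm]
    refine Summable.mul_right _ (Summable.mul_left _ ?_)
    have hs := ha.norm
    refine Summable.of_nonneg_of_le (fun n ↦ by positivity) (fun n ↦ ?_) (hs.mul_left (Real.exp (u * c)))
    rw [LSeries.norm_term_eq, hnβ]
    rcases eq_or_ne n 0 with rfl | hn
    · simp
    · rw [if_neg hn, if_neg hn]
      have hn0 : (0 : ℝ) < n := by exact_mod_cast Nat.pos_of_ne_zero hn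
      have hre : (((β + c : ℝ) : ℂ)).re = β + c := by simp
      rw [hre, Real.rpow_add hn0, Real.rpow_neg hn0.le,
        show (u - Real.log n) * c = u * c + -(Real.log n * c) by ring, Real.exp_add, Real.exp_neg,
        ← Real.rpow_def_of_pos hn0]
      apply le_of_eq
      have h1 : (n : ℝ) ^ β ≠ 0 := (Real.rpow_pos_of_pos hn0 _).ne'
      have h2 : (n : ℝ) ^ c ≠ 0 := (Real.rpow_pos_of_pos hn0 _).ne'
      field_simp
  -- (iv) the pointwise sum
  have hinner : ∀ t : ℝ, ∑' n, F n t = (1 / (2 * π) : ℝ) *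
      (Complex.exp (-(u : ℂ) * sv t) * Λk t * LSeries a ((β : ℂ) - sv t)) := by
    intro t
    rw [LSeries, ← tsum_mul_left, ← tsum_mul_left]
    refine tsum_congr fun n ↦ ?_
    rw [hF, term_sub_eq a hβ]
    dsimp only
    rw [show Complex.exp (-((u - Real.log n : ℝ) : ℂ) * sv t) =
      Complex.exp (-(u : ℂ) * sv t) * Complex.exp ((Real.log n : ℂ) * sv t) by
        rw [← Complex.exp_add]; push_cast; ring_nf]
    ring
  -- assemble
  rw [longSum]
  simp_rw [hterm]
  rw [integral_tsum_of_summable_integral_norm hFi hsum]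
  simp_rw [hinner]
  rw [integral_const_mul]
  congr 1
  refine integral_congr_ae (Eventually.of_forall fun t ↦ ?_)
  simp only [hΛk, hsv]
  ring

/-! ### Moving the line across the pole at `s = −δ`; the zero `F(β) = 0` cancels `1/s` -/

/-- **The long sum with the main term extracted, at a zero `β` of the `L`-series.**  Let
`Σ |a(n)| n^{−β−1/2} < ∞`, `L(a, z) = F(z)/(z − 1)` on `Re z > 1` for an entire `F` with
`|F(z)| ≤ M |z + 5/2|^N` on `Re z ≥ −1/2`, `m ≥ N + 2`, `3/4 ≤ β < 1`, and `F(β) = 0`.  Then with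
`δ = 1 − β`, for every real `u`,
`longSum a β A m u = F(1) Ψ̂(−δ) e^{uδ}/δ + (1/2π) ∫ e^{−us} Ψ̂(s) F(β − s)/(s(s + δ)) dt`, `s = 1/2 + it`:
the line `Re s = −1/2` of `longSum_eq_integral` is moved to `Re s = 1/2` across the simple pole at
`s = −δ` of `L(a, β − s) = −F(β − s)/(s + δ)`; at `s = 0` the kernel's `1/s` is cancelled by
`F(β) = 0` (the function `F(β − s)/s` is entire: Mathlib's `dslope`).
[cite: Bombieri1987GrandCrible, §6 Lemme C] -/
theorem longSum_eq_add_integral (hA : 0 < A) {m N : ℕ} (hNm : N + 2 ≤ m) {a : ℕ → ℂ} {β : ℝ}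
    (hβ : 3 / 4 ≤ β) (hβ1 : β < 1) (ha : LSeriesSummable a ((β + 1 / 2 : ℝ) : ℂ)) {F : ℂ → ℂ}
    (hF : Differentiable ℂ F) (hLF : ∀ z : ℂ, 1 < z.re → LSeries a z = F z / (z - 1)) (hFβ : F β = 0)
    {M : ℝ} (hM : 0 ≤ M) (hbd : ∀ z : ℂ, -1 / 2 ≤ z.re → ‖F z‖ ≤ M * ‖z + 5 / 2‖ ^ N) (u : ℝ) :
    longSum a β A m u = F 1 * laplaceFactor A (-((1 - β : ℝ) : ℂ)) ^ (m + 1) *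
        Complex.exp (u * (1 - β)) / ((1 - β : ℝ) : ℂ) + (1 / (2 * π) : ℝ) *
      ∫ t : ℝ, Complex.exp (-(u : ℂ) * ((1 / 2 : ℝ) + t * I)) *
        laplaceFactor A ((1 / 2 : ℝ) + t * I) ^ (m + 1) *
          (F ((β : ℂ) - ((1 / 2 : ℝ) + t * I)) /
            (((1 / 2 : ℝ) + t * I) * (((1 / 2 : ℝ) + t * I) + ((1 - β : ℝ) : ℂ)))) := by
  have hm1 : 1 ≤ m := by omega
  set δ : ℝ := 1 - β with hδ
  have hδ0 : 0 < δ := by rw [hδ]; linarith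
  have hδ4 : δ ≤ 1 / 4 := by rw [hδ]; linarith
  have hβ0 : β ≠ 0 := by linarith
  -- the entire function `q(s) = F(β − s)/s`
  set h : ℂ → ℂ := fun s ↦ F ((β : ℂ) - s) with hh
  have hhd : Differentiable ℂ h := hF.comp (by fun_prop)
  have hh0 : h 0 = 0 := by rw [hh]; simpa using hFβ
  set q : ℂ → ℂ := dslope h 0 with hq
  have hq_of_ne : ∀ {s : ℂ}, s ≠ 0 → q s = F ((β : ℂ) - s) / s := by
    intro s hs
    rw [hq, dslope_of_ne _ hs, slope_def_field, hh0, sub_zero, sub_zero, hh]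
  have hqd : Differentiable ℂ q := by
    intro s
    by_cases hs : s = 0
    · subst hs
      obtain ⟨p, hp⟩ := hhd.analyticAt 0
      exact hp.has_fpower_series_dslope_fslope.analyticAt.differentiableAt
    · rw [hq, differentiableAt_dslope_of_ne hs]
      exact hhd s
  set g : ℂ → ℂ := fun s ↦ Complex.exp (-(u : ℂ) * s) * laplaceFactor A s ^ (m + 1) * q s with hg
  have hgd : Differentiable ℂ g := by
    rw [hg]
    exact ((Differentiable.mul (by fun_prop) ((differentiable_laplaceFactor hA).pow _)).mul hqd)
  set p : ℂ := -(δ : ℂ) with hp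
  have hpre : p.re = -δ := by simp [hp]
  -- the bound for `F(β − s)` on the strip `-1/2 ≤ Re s ≤ 1/2`
  have hFb : ∀ (x : ℝ), x ∈ Icc (-1 / 2 : ℝ) (1 / 2) → ∀ t : ℝ,
      ‖F ((β : ℂ) - (x + t * I))‖ ≤ M * (9 / 2 + |t|) ^ N := by
    intro x hx t
    obtain ⟨hx1, hx2⟩ := hx
    refine (hbd _ (by simp; linarith)).trans (mul_le_mul_of_nonneg_left ?_ hM)
    refine pow_le_pow_left₀ (norm_nonneg _) ?_ N
    have e : (β : ℂ) - (x + t * I) + 5 / 2 = ((β - x + 5 / 2 : ℝ) : ℂ) + (-t) * I := by push_cast; ring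
    rw [e]
    refine (norm_add_le _ _).trans ?_
    rw [Complex.norm_real, norm_mul, Complex.norm_I, mul_one, norm_neg, Complex.norm_real,
      Real.norm_eq_abs, Real.norm_eq_abs, abs_of_pos (by linarith)]
    linarith
  set Kc : ℝ := Real.exp (1 / 2 * |u|) * M * majorConst A m N with hKc
  have hKc0 : 0 ≤ Kc := mul_nonneg (mul_nonneg (Real.exp_pos _).le hM) (majorConst_pos _ _ _).le
  -- norms of `x + tI` and `x + tI + δ`
  have him : ∀ (x t : ℝ), |t| ≤ ‖(x : ℂ) + t * I‖ := fun x t ↦ by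
    have := Complex.abs_im_le_norm ((x : ℂ) + t * I); simpa using this
  have hre : ∀ (x t : ℝ), |x| ≤ ‖(x : ℂ) + t * I‖ := fun x t ↦ by
    have := Complex.abs_re_le_norm ((x : ℂ) + t * I); simpa using this
  have hshiftδ : ∀ (x t : ℝ), (x : ℂ) + t * I - p = ((x + δ : ℝ) : ℂ) + t * I := by
    intro x t; rw [hp]; push_cast; ring
  have hexp : ∀ (x t : ℝ), x ∈ Icc (-1 / 2 : ℝ) (1 / 2) →
      ‖Complex.exp (-(u : ℂ) * (x + t * I))‖ ≤ Real.exp (1 / 2 * |u|) := by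
    intro x t hx
    rw [Complex.norm_exp]
    refine Real.exp_le_exp.mpr ?_
    have : (-(u : ℂ) * (x + t * I)).re = -(u * x) := by simp
    rw [this]
    have hxabs : |x| ≤ 1 / 2 := abs_le.mpr ⟨by linarith [hx.1], hx.2⟩
    calc -(u * x) ≤ |u * x| := neg_le_abs _
      _ = |u| * |x| := abs_mul _ _
      _ ≤ |u| * (1 / 2) := mul_le_mul_of_nonneg_left hxabs (abs_nonneg _)
      _ = 1 / 2 * |u| := by ring
  -- the majorant `‖g(s)/(s − p)‖ ≤ Kc / ((1+t²) |s| |s+δ|)` on the strip, off `s = 0`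
  have hmajor : ∀ (x : ℝ), x ∈ Icc (-1 / 2 : ℝ) (1 / 2) → ∀ t : ℝ, (x : ℂ) + t * I ≠ 0 →
      ((x + δ : ℝ) : ℂ) + t * I ≠ 0 →
      ‖g (x + t * I) / (x + t * I - p)‖ ≤
        Kc / (1 + t ^ 2) / (‖(x : ℂ) + t * I‖ * ‖((x + δ : ℝ) : ℂ) + t * I‖) := by
    intro x hx t hs0 hsp
    have hxabs : |x| ≤ 3 / 2 := abs_le.mpr ⟨by linarith [hx.1], by linarith [hx.2]⟩
    rw [hshiftδ, norm_div, hg]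
    dsimp only
    rw [hq_of_ne hs0, norm_mul, norm_mul, norm_div]
    have h3 := norm_laplaceFactor_pow_mul_le hA hNm hxabs t
    have hpos2 : 0 < ‖((x + δ : ℝ) : ℂ) + t * I‖ := norm_pos_iff.mpr hsp
    have eq : ‖Complex.exp (-(u : ℂ) * (x + t * I))‖ * ‖laplaceFactor A (x + t * I) ^ (m + 1)‖ *
        (‖F ((β : ℂ) - (x + t * I))‖ / ‖(x : ℂ) + t * I‖) / ‖((x + δ : ℝ) : ℂ) + t * I‖ =
        ‖Complex.exp (-(u : ℂ) * (x + t * I))‖ * ‖laplaceFactor A (x + t * I) ^ (m + 1)‖ *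
          ‖F ((β : ℂ) - (x + t * I))‖ / (‖(x : ℂ) + t * I‖ * ‖((x + δ : ℝ) : ℂ) + t * I‖) := by
      ring
    rw [eq]
    refine div_le_div_of_nonneg_right ?_ (by positivity)
    calc ‖Complex.exp (-(u : ℂ) * (x + t * I))‖ * ‖laplaceFactor A (x + t * I) ^ (m + 1)‖ *
          ‖F ((β : ℂ) - (x + t * I))‖
        ≤ Real.exp (1 / 2 * |u|) * ‖laplaceFactor A (x + t * I) ^ (m + 1)‖ * (M * (9 / 2 + |t|) ^ N) :=
          mul_le_mul (mul_le_mul_of_nonneg_right (hexp x t hx) (norm_nonneg _)) (hFb x hx t)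
            (norm_nonneg _) (by positivity)
      _ = Real.exp (1 / 2 * |u|) * M * (‖laplaceFactor A (x + t * I) ^ (m + 1)‖ * (9 / 2 + |t|) ^ N) := by
          ring
      _ ≤ Real.exp (1 / 2 * |u|) * M * (majorConst A m N / (1 + t ^ 2)) :=
          mul_le_mul_of_nonneg_left h3 (by positivity)
      _ = Kc / (1 + t ^ 2) := by rw [hKc]; ring
  -- continuity along the lines `Re s = ±1/2`
  have hne : ∀ {x : ℝ}, x ≠ 0 → ∀ t : ℝ, (x : ℂ) + t * I ≠ 0 := by
    intro x hx t h0
    have := congrArg Complex.re h0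
    simp at this
    exact hx this
  have hne' : ∀ {x : ℝ}, x + δ ≠ 0 → ∀ t : ℝ, (x : ℂ) + t * I - p ≠ 0 := by
    intro x hx t h0
    rw [hshiftδ] at h0
    have := congrArg Complex.re h0
    simp at this
    exact hx this
  have hgline : ∀ {x : ℝ}, x + δ ≠ 0 → Continuous fun t : ℝ ↦ g (x + t * I) / (x + t * I - p) := by
    intro x hx
    exact (hgd.continuous.comp (by fun_prop)).div (by fun_prop) (hne' hx)
  -- integrability on the two lines
  have hint : ∀ {x : ℝ}, x ∈ Icc (-1 / 2 : ℝ) (1 / 2) → x ≠ 0 → 1 / 4 ≤ |x + δ| →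
      Integrable fun t : ℝ ↦ g (x + t * I) / (x + t * I - p) := by
    intro x hx hx0 hxδ
    have hxδ0 : x + δ ≠ 0 := fun h0 ↦ by rw [h0, abs_zero] at hxδ; linarith
    have hxpos : 0 < |x| := abs_pos.mpr hx0
    refine Integrable.mono' ((integrable_inv_one_add_sq).const_mul (Kc / (|x| * (1 / 4))))
      (hgline hxδ0).aestronglyMeasurable (Eventually.of_forall fun t ↦ ?_)
    have h1 := hmajor x hx t (hne hx0 t) (by rw [← hshiftδ]; exact hne' hxδ0 t)
    have hA' : |x| ≤ ‖(x : ℂ) + t * I‖ := hre x t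
    have hB' : 1 / 4 ≤ ‖((x + δ : ℝ) : ℂ) + t * I‖ := hxδ.trans (hre (x + δ) t)
    calc ‖g (x + t * I) / (x + t * I - p)‖
        ≤ Kc / (1 + t ^ 2) / (‖(x : ℂ) + t * I‖ * ‖((x + δ : ℝ) : ℂ) + t * I‖) := h1
      _ ≤ Kc / (1 + t ^ 2) / (|x| * (1 / 4)) := by
          refine div_le_div_of_nonneg_left (by positivity) (mul_pos hxpos (by norm_num)) ?_
          exact mul_le_mul hA' hB' (by norm_num) (norm_nonneg _)
      _ = Kc / (|x| * (1 / 4)) * (1 + t ^ 2)⁻¹ := by ring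
  -- decay on horizontal segments
  have hdecay : ∀ ε : ℝ, 0 < ε → ∃ T₀ : ℝ, ∀ T : ℝ, T₀ ≤ |T| → ∀ x ∈ Icc (-1 / 2 : ℝ) (1 / 2),
      ‖g (x + T * I) / (x + T * I - p)‖ ≤ ε := by
    intro ε hε
    refine ⟨max 1 (Real.sqrt (Kc / ε) + 1), fun T hT x hx ↦ ?_⟩
    have hT1 : 1 ≤ |T| := le_trans (le_max_left _ _) hT
    have hT2 : Real.sqrt (Kc / ε) + 1 ≤ |T| := le_trans (le_max_right _ _) hT
    have hs0 : (x : ℂ) + T * I ≠ 0 := by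
      intro h0; have := congrArg Complex.im h0; simp at this; rw [this] at hT1; norm_num at hT1
    have hsp : ((x + δ : ℝ) : ℂ) + T * I ≠ 0 := by
      intro h0; have := congrArg Complex.im h0; simp at this; rw [this] at hT1; norm_num at hT1
    have h1 := hmajor x hx T hs0 hsp
    have hA' : |T| ≤ ‖(x : ℂ) + T * I‖ := him x T
    have hB' : |T| ≤ ‖((x + δ : ℝ) : ℂ) + T * I‖ := him (x + δ) T
    have hT0 : 0 < |T| := by linarith
    have h2 : ‖g (x + T * I) / (x + T * I - p)‖ ≤ Kc / T ^ 2 := by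
      calc ‖g (x + T * I) / (x + T * I - p)‖
          ≤ Kc / (1 + T ^ 2) / (‖(x : ℂ) + T * I‖ * ‖((x + δ : ℝ) : ℂ) + T * I‖) := h1
        _ ≤ Kc / (1 + T ^ 2) / (|T| * |T|) := by
            refine div_le_div_of_nonneg_left (by positivity) (mul_pos hT0 hT0) ?_
            exact mul_le_mul hA' hB' hT0.le (norm_nonneg _)
        _ ≤ Kc / (|T| * |T|) := by
            refine div_le_div_of_nonneg_right ?_ (by positivity)
            exact div_le_self hKc0 (by nlinarith)
        _ = Kc / T ^ 2 := by rw [← sq, sq_abs]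
    refine h2.trans ?_
    rcases eq_or_lt_of_le hKc0 with h0 | hpos
    · rw [← h0, zero_div]; exact hε.le
    · have hsq : Real.sqrt (Kc / ε) < |T| := by linarith
      have hKε : Kc / ε < T ^ 2 := by
        have := Real.lt_sq_of_sqrt_lt hsq
        rwa [sq_abs] at this
      rw [div_lt_iff₀ hε] at hKε
      have hT2pos : 0 < T ^ 2 := by rw [← sq_abs]; positivity
      rw [div_le_iff₀ hT2pos]
      linarith
  -- the pole shift
  have haI : (-1 / 2 : ℝ) ∈ Icc (-1 / 2 : ℝ) (1 / 2) := ⟨le_rfl, by norm_num⟩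
  have hbI : (1 / 2 : ℝ) ∈ Icc (-1 / 2 : ℝ) (1 / 2) := ⟨by norm_num, le_rfl⟩
  have hinta := hint haI (by norm_num) (by rw [abs_of_neg (by linarith)]; linarith)
  have hintb := hint hbI (by norm_num) (by rw [abs_of_pos (by linarith)]; linarith)
  have hshift := Montgomery.integral_vertical_div_sub_eq (g := g) (a := -1 / 2) (b := 1 / 2) (p := p)
    (by rw [hpre]; linarith) (by rw [hpre]; linarith) hgd.differentiableOn hinta hintb hdecay
  -- `g(p) = -e^{uδ} Ψ̂(-δ) F(1)/δ`
  have hp0 : p ≠ 0 := by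
    rw [hp, neg_ne_zero]; exact_mod_cast hδ0.ne'
  have hgp : g p = -(F 1 * laplaceFactor A (-((1 - β : ℝ) : ℂ)) ^ (m + 1) *
      Complex.exp (u * (1 - β)) / ((1 - β : ℝ) : ℂ)) := by
    rw [hg]; dsimp only
    rw [hq_of_ne hp0, hp]
    have e1 : (β : ℂ) - -(δ : ℂ) = 1 := by rw [hδ]; push_cast; ring
    rw [e1]
    have e2 : -(u : ℂ) * -(δ : ℂ) = u * (1 - β) := by rw [hδ]; push_cast; ring
    rw [e2, hδ]
    have hδc : ((1 - β : ℝ) : ℂ) ≠ 0 := by exact_mod_cast hδ0.ne'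
    field_simp
  -- the left line is `2π · longSum`
  have hleft : ∀ t : ℝ, g (((-1 / 2 : ℝ) : ℂ) + t * I) / (((-1 / 2 : ℝ) : ℂ) + t * I - p) =
      Complex.exp (-(u : ℂ) * ((-(1 / 2 : ℝ) : ℝ) + t * I)) *
        laplaceFactor A ((-(1 / 2 : ℝ) : ℝ) + t * I) ^ (m + 1) * (-1 / ((-(1 / 2 : ℝ) : ℝ) + t * I)) *
          LSeries a ((β : ℂ) - ((-(1 / 2 : ℝ) : ℝ) + t * I)) := by
    intro t
    have hs0 : ((-1 / 2 : ℝ) : ℂ) + t * I ≠ 0 := hne (by norm_num) t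
    have hsp : ((-1 / 2 : ℝ) : ℂ) + t * I - p ≠ 0 := hne' (by linarith) t
    have e : ((-(1 / 2 : ℝ) : ℝ) : ℂ) = ((-1 / 2 : ℝ) : ℂ) := by push_cast; ring
    rw [e, hLF _ (by simp; linarith), hg]
    dsimp only
    rw [hq_of_ne hs0]
    have hz1 : (β : ℂ) - (((-1 / 2 : ℝ) : ℂ) + t * I) - 1 = -((((-1 / 2 : ℝ) : ℂ) + t * I) - p) := by
      rw [hp, hδ]; push_cast; ring
    rw [hz1]
    field_simp
  have hright : ∀ t : ℝ, g (((1 / 2 : ℝ) : ℂ) + t * I) / (((1 / 2 : ℝ) : ℂ) + t * I - p) =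
      Complex.exp (-(u : ℂ) * ((1 / 2 : ℝ) + t * I)) *
        laplaceFactor A ((1 / 2 : ℝ) + t * I) ^ (m + 1) *
          (F ((β : ℂ) - ((1 / 2 : ℝ) + t * I)) /
            (((1 / 2 : ℝ) + t * I) * (((1 / 2 : ℝ) + t * I) + ((1 - β : ℝ) : ℂ)))) := by
    intro t
    have hs0 : ((1 / 2 : ℝ) : ℂ) + t * I ≠ 0 := hne (by norm_num) t
    rw [hg]
    dsimp only
    rw [hq_of_ne hs0, hp, hδ, sub_neg_eq_add]
    field_simp
  simp_rw [hleft, hright, hgp] at hshift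
  rw [longSum_eq_integral hA hm1 (c := 1 / 2) (by norm_num) hβ0 ha u]
  set L := ∫ t : ℝ, Complex.exp (-(u : ℂ) * ((-(1 / 2 : ℝ) : ℝ) + t * I)) *
    laplaceFactor A ((-(1 / 2 : ℝ) : ℝ) + t * I) ^ (m + 1) * (-1 / ((-(1 / 2 : ℝ) : ℝ) + t * I)) *
      LSeries a ((β : ℂ) - ((-(1 / 2 : ℝ) : ℝ) + t * I)) with hL
  set R := ∫ t : ℝ, Complex.exp (-(u : ℂ) * ((1 / 2 : ℝ) + t * I)) *
    laplaceFactor A ((1 / 2 : ℝ) + t * I) ^ (m + 1) *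
      (F ((β : ℂ) - ((1 / 2 : ℝ) + t * I)) /
        (((1 / 2 : ℝ) + t * I) * (((1 / 2 : ℝ) + t * I) + ((1 - β : ℝ) : ℂ)))) with hR
  set Mn : ℂ := F 1 * laplaceFactor A (-((1 - β : ℝ) : ℂ)) ^ (m + 1) *
      Complex.exp (u * (1 - β)) / ((1 - β : ℝ) : ℂ) with hMn
  have hLR : L = R + 2 * π * Mn := by
    have h : I * L = I * (R + 2 * π * Mn) := by linear_combination -hshift
    exact mul_left_cancel₀ Complex.I_ne_zero h
  rw [hLR]
  push_cast
  field_simp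
  ring

/-- **The bound for the long sum at a zero** (Lemme C's analytic input): under the hypotheses of
`longSum_eq_add_integral`,
`|longSum a β A m u − F(1) Ψ̂(−δ) e^{uδ}/δ| ≤ 2 M C e^{−u/2}`, `C = majorConst A m N`, `δ = 1 − β`
(on `Re s = 1/2`: `|e^{−us}| = e^{−u/2}`, `|Ψ̂(s)||F(β − s)| ≤ M C/(1 + t²)`, `|1/s|, |1/(s+δ)| ≤ 2`,
`∫ dt/(1+t²) = π`). [cite: Bombieri1987GrandCrible, §6 Lemme C] -/
theorem norm_longSum_sub_le (hA : 0 < A) {m N : ℕ} (hNm : N + 2 ≤ m) {a : ℕ → ℂ} {β : ℝ}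
    (hβ : 3 / 4 ≤ β) (hβ1 : β < 1) (ha : LSeriesSummable a ((β + 1 / 2 : ℝ) : ℂ)) {F : ℂ → ℂ}
    (hF : Differentiable ℂ F) (hLF : ∀ z : ℂ, 1 < z.re → LSeries a z = F z / (z - 1)) (hFβ : F β = 0)
    {M : ℝ} (hM : 0 ≤ M) (hbd : ∀ z : ℂ, -1 / 2 ≤ z.re → ‖F z‖ ≤ M * ‖z + 5 / 2‖ ^ N) (u : ℝ) :
    ‖longSum a β A m u - F 1 * laplaceFactor A (-((1 - β : ℝ) : ℂ)) ^ (m + 1) *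
        Complex.exp (u * (1 - β)) / ((1 - β : ℝ) : ℂ)‖ ≤
      2 * M * majorConst A m N * Real.exp (-(1 / 2 * u)) := by
  rw [longSum_eq_add_integral hA hNm hβ hβ1 ha hF hLF hFβ hM hbd u, add_sub_cancel_left, norm_mul,
    Complex.norm_real, Real.norm_eq_abs, abs_of_pos (by positivity)]
  set C := majorConst A m N with hC
  have hC0 : 0 < C := majorConst_pos A m N
  set δ : ℝ := 1 - β with hδ
  have hδ0 : 0 < δ := by rw [hδ]; linarith
  -- pointwise bound on `Re s = 1/2`
  have hpt : ∀ t : ℝ, ‖Complex.exp (-(u : ℂ) * ((1 / 2 : ℝ) + t * I)) *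
      laplaceFactor A ((1 / 2 : ℝ) + t * I) ^ (m + 1) *
        (F ((β : ℂ) - ((1 / 2 : ℝ) + t * I)) /
          (((1 / 2 : ℝ) + t * I) * (((1 / 2 : ℝ) + t * I) + ((1 - β : ℝ) : ℂ))))‖ ≤
      (4 * Real.exp (-(1 / 2 * u)) * M * C) * (1 + t ^ 2)⁻¹ := by
    intro t
    rw [norm_mul, norm_mul, norm_div, norm_mul]
    have h1 : ‖Complex.exp (-(u : ℂ) * ((1 / 2 : ℝ) + t * I))‖ = Real.exp (-(1 / 2 * u)) := by
      rw [Complex.norm_exp]; congr 1; simp; ring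
    have h2 : ‖F ((β : ℂ) - ((1 / 2 : ℝ) + t * I))‖ ≤ M * (9 / 2 + |t|) ^ N := by
      refine (hbd _ (by simp; linarith)).trans (mul_le_mul_of_nonneg_left ?_ hM)
      refine pow_le_pow_left₀ (norm_nonneg _) ?_ N
      have e : (β : ℂ) - ((1 / 2 : ℝ) + t * I) + 5 / 2 = ((β + 2 : ℝ) : ℂ) + (-t) * I := by
        push_cast; ring
      rw [e]
      refine (norm_add_le _ _).trans ?_
      rw [Complex.norm_real, norm_mul, Complex.norm_I, mul_one, norm_neg, Complex.norm_real,
        Real.norm_eq_abs, Real.norm_eq_abs, abs_of_pos (by linarith)]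
      linarith
    have h3 : (1 / 2 : ℝ) ≤ ‖((1 / 2 : ℝ) : ℂ) + t * I‖ := by
      have := Complex.re_le_norm (((1 / 2 : ℝ) : ℂ) + t * I)
      simp only [Complex.add_re, Complex.ofReal_re, Complex.mul_re, Complex.I_re, mul_zero,
        Complex.ofReal_im, Complex.I_im, mul_one, sub_self, add_zero] at this
      exact this
    have h3' : (1 / 2 : ℝ) ≤ ‖((1 / 2 : ℝ) : ℂ) + t * I + ((1 - β : ℝ) : ℂ)‖ := by
      have := Complex.re_le_norm (((1 / 2 : ℝ) : ℂ) + t * I + ((1 - β : ℝ) : ℂ))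
      simp only [Complex.add_re, Complex.ofReal_re, Complex.mul_re, Complex.I_re, mul_zero,
        Complex.ofReal_im, Complex.I_im, mul_one, sub_self, add_zero] at this
      linarith
    have h4 := norm_laplaceFactor_pow_mul_le hA hNm (σ := 1 / 2) (by rw [abs_of_pos (by norm_num)]; norm_num) t
    have hden : (1 / 4 : ℝ) ≤ ‖((1 / 2 : ℝ) : ℂ) + t * I‖ * ‖((1 / 2 : ℝ) : ℂ) + t * I + ((1 - β : ℝ) : ℂ)‖ := by
      have := mul_le_mul h3 h3' (by norm_num) (norm_nonneg _)
      linarith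
    have hden0 : 0 < ‖((1 / 2 : ℝ) : ℂ) + t * I‖ * ‖((1 / 2 : ℝ) : ℂ) + t * I + ((1 - β : ℝ) : ℂ)‖ := by
      linarith
    rw [h1]
    calc Real.exp (-(1 / 2 * u)) * ‖laplaceFactor A ((1 / 2 : ℝ) + t * I) ^ (m + 1)‖ *
          (‖F ((β : ℂ) - ((1 / 2 : ℝ) + t * I))‖ /
            (‖((1 / 2 : ℝ) : ℂ) + t * I‖ * ‖((1 / 2 : ℝ) : ℂ) + t * I + ((1 - β : ℝ) : ℂ)‖))
        ≤ Real.exp (-(1 / 2 * u)) * ‖laplaceFactor A ((1 / 2 : ℝ) + t * I) ^ (m + 1)‖ *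
          (M * (9 / 2 + |t|) ^ N / (1 / 4)) := by
          refine mul_le_mul_of_nonneg_left (div_le_div₀ (by positivity) h2 (by norm_num) hden) (by positivity)
      _ = 4 * Real.exp (-(1 / 2 * u)) * M *
          (‖laplaceFactor A ((1 / 2 : ℝ) + t * I) ^ (m + 1)‖ * (9 / 2 + |t|) ^ N) := by ring
      _ ≤ 4 * Real.exp (-(1 / 2 * u)) * M * (C / (1 + t ^ 2)) :=
          mul_le_mul_of_nonneg_left h4 (by positivity)
      _ = (4 * Real.exp (-(1 / 2 * u)) * M * C) * (1 + t ^ 2)⁻¹ := by rw [div_eq_mul_inv]; ring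
  have hint := norm_integral_le_of_norm_le ((integrable_inv_one_add_sq).const_mul
    (4 * Real.exp (-(1 / 2 * u)) * M * C)) (Eventually.of_forall hpt)
  rw [integral_const_mul, integral_univ_inv_one_add_sq] at hint
  calc 1 / (2 * π) * ‖∫ t : ℝ, Complex.exp (-(u : ℂ) * ((1 / 2 : ℝ) + t * I)) *
        laplaceFactor A ((1 / 2 : ℝ) + t * I) ^ (m + 1) *
          (F ((β : ℂ) - ((1 / 2 : ℝ) + t * I)) /
            (((1 / 2 : ℝ) + t * I) * (((1 / 2 : ℝ) + t * I) + ((1 - β : ℝ) : ℂ))))‖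
      ≤ 1 / (2 * π) * ((4 * Real.exp (-(1 / 2 * u)) * M * C) * π) :=
        mul_le_mul_of_nonneg_left hint (by positivity)
    _ = 2 * M * C * Real.exp (-(1 / 2 * u)) := by field_simp; ring

/-! ### The main-term factor `Ψ̂(−δ)` is real and at least `1` -/

/-- `sinh(s/A)/(s/A)` is even. [folklore] -/
theorem laplaceFactor_neg (A : ℝ) (s : ℂ) : laplaceFactor A (-s) = laplaceFactor A s := by
  by_cases hs : s = 0
  · subst hs; simp
  · rw [laplaceFactor, if_neg (neg_ne_zero.mpr hs), laplaceFactor, if_neg hs, neg_div, Complex.sinh_neg,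
      neg_div_neg_eq]

/-- For real `x ≠ 0`: `sinh(x/A)/(x/A)` is the real number `Real.sinh(x/A)/(x/A)`. [folklore] -/
theorem laplaceFactor_ofReal (A : ℝ) {x : ℝ} (hx : x ≠ 0) :
    laplaceFactor A (x : ℂ) = ((Real.sinh (x / A) / (x / A) : ℝ) : ℂ) := by
  rw [laplaceFactor, if_neg (by exact_mod_cast hx), Complex.ofReal_div, Complex.ofReal_sinh,
    Complex.ofReal_div]

/-- `1 ≤ sinh(y)/y` for real `y > 0`. [folklore] -/
theorem one_le_sinh_div {y : ℝ} (hy : 0 < y) : 1 ≤ Real.sinh y / y := by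
  rw [le_div_iff₀ hy, one_mul]
  exact Real.self_le_sinh_iff.mpr hy.le

/-- **`Ψ̂(−δ) = Ψ̂(δ)` is a real number `≥ 1`** for `δ > 0`, `A > 0`: there is a real `ψ ≥ 1` with
`laplaceFactor A (−δ)^{m+1} = ψ`. [folklore] -/
theorem exists_laplaceFactor_pow_neg_eq (hA : 0 < A) (m : ℕ) {δ : ℝ} (hδ : 0 < δ) :
    ∃ ψ : ℝ, 1 ≤ ψ ∧ laplaceFactor A (-(δ : ℂ)) ^ (m + 1) = (ψ : ℂ) := by
  refine ⟨(Real.sinh (δ / A) / (δ / A)) ^ (m + 1), one_le_pow₀ (one_le_sinh_div (by positivity)), ?_⟩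
  rw [laplaceFactor_neg, laplaceFactor_ofReal A hδ.ne']
  push_cast
  ring

end Literature.NumberTheory.LFunctions.WeissKernel

end
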